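import Summits.NavierStokesRegularity.NavierStokesRegularity.Theses.AxisymmetricExtremality
import Summits.NavierStokesRegularity.NavierStokesRegularity.Theorems.AxisymmetricExtremalityAxisymmetricKatoGlobalStubSereginLogSwirlOriginStep3CutoffCalculus
import Summits.NavierStokesRegularity.NavierStokesRegularity.Theorems.AxisymmetricExtremalityAxisymmetricKatoGlobalStubSereginLogSwirlOriginCutoffDivCurl
import Literature.Analysis.FluidPDE.HouLiSpaceTime
import Literature.Analysis.FluidPDE.SpaceTimeCalculus
import HarnessLib

/-!
# Seregin 2022, §2 Step 3: time-dependent cut-offs — the weighted energy `∫(η³G)²`, its time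
# derivative, and the passage from the fixed-time to the time-integrated localised energy
# inequality — crux stmt-NavierStokesRegularity-15453 (`AxisymmetricExtremality.AxisymmetricKatoGlobal`), line registered, support for stub `stub_sereginLogSwirlOrigin`

Support file (`--supports stmt-NavierStokesRegularity-15453`; theorems only, everything proved)
toward the registered stub `stub_sereginLogSwirlOrigin` = the named fact
`Literature.Analysis.FluidPDE.seregin2022_logSwirl_regularAtOrigin` (G. Seregin, J. Math. Fluid
Mech. 24 (2022), Paper 27 = arXiv:2201.00153, §2). In Step 3 (arXiv pp. 6–7) the cut-off
`η = φ(r)ψ(x₃)ξ(t)` depends on time, the energy terms are `½∂ₜ∫(Gη³)²` and `½∫G²∂ₜη⁶`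
(`G = Φ, Γ`), and the final "key estimate"
`sup_t ∫η⁶(|Γ|²+|Φ|²) + ∫_Q (η³|∇Φ|)² + (η³|∇Γ|)² ≤ C` is obtained from the differential
inequality "by more or less standard arguments", the first of which is integration in time. This
file supplies, for families jointly smooth on an OPEN time interval `S` (classical solutions on a
singularity-free slab) and a cut-off `ζ = η³` jointly smooth and vanishing off a fixed compact `K`:

* `hasDerivAt_integral_cutoff_sq` — `d/dt ∫(ζG)² = 2∫ζ∂ₜζG² + 2∫ζ²G∂ₜG` (differentiation under
  the integral sign, `hasDerivAt_integral_of_support_subset`);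
* `integral_cutoff_sq_sub_eq` — the balance `∫(ζG)²(t₂) − ∫(ζG)²(t₁) = ∫_{t₁}^{t₂}(…)dt` on
  `[t₁, t₂] ⊆ S`, with continuity of the density;
* `integral_cutoff_sq_add_le_of_forall_le` (registered sub-goal) — **from the fixed-time
  inequality to the integrated one**: if at every `t ∈ S`
  `∫ζ²G∂ₜG + ν∫|∇(ζG)|² ≤ ∫ζG²Dζ[b] + ν∫G²|∇ζ|² − 2ν∫ζG²q_ζ + ∫ζ²GR` (the shape of
  `integral_cutoff_energy_le`, sibling file `…Step3Gamma`; `R`, `b` jointly smooth), then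
  `E(t₂) + 2ν∫_{t₁}^{t₂}∫|∇(ζG)|² ≤ E(t₁) + ∫_{t₁}^{t₂}[2∫ζ∂ₜζG² + 2∫ζG²Dζ[b] + 2ν∫G²|∇ζ|²
  − 4ν∫ζG²q_ζ + 2∫ζ²GR] dt`, `E(t) = ∫(ζG)²(t)`, every time integrand being continuous on `S`
  (joint smoothness of all integrands: `IsSmoothSpaceTimeOn.mul / fderiv_slice(_apply) /
  radDerivQuot_family / timeDerivWithin`, and `continuousOn_integral_of_support_subset`).

The specialisations to `Γ = angVortQuot` and `Φ = radVelQuot ∘ curl` of a classical axisymmetric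
Navier–Stokes solution are the sibling file `…Step3Integrated`.

## Mathlib / tree search

Tree: `hasDerivAt_integral_of_support_subset`, `continuousOn_integral_of_support_subset`,
`IsSmoothSpaceTimeOn.hasDerivAt_timeLine`, `timeDerivWithin_eq_deriv`,
`IsSmoothSpaceTimeOn.mul`, `isSmoothSpaceTimeOn_const_time` (`SpaceTimeCalculus`),
`IsSmoothSpaceTimeOn.timeDerivWithin`, `.contDiff_slice`, `.continuousOn`
(`ClassicalSolutionCalculus`), `IsSmoothSpaceTimeOn.fderiv_slice(_apply)` (`EnergyToolkit`),
`IsSmoothSpaceTimeOn.radDerivQuot_family` (`HouLiSpaceTime`), `integrable_sq_mul_mul`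
(`…Step3CutoffCalculus`); the analogous GLOBAL balances `Wei2016.weighted_sq_balance`
(`Wei2016WeightedBalance`, static weight `r⁻²`, slab `[0, T]`) and `IsSmoothSpaceTimeOn.l2_balance`
(`ClassicalL2Stability`). Mathlib: `intervalIntegral.integral_eq_sub_of_hasDerivAt`,
`intervalIntegral.integral_mono_on`, `ContinuousOn.intervalIntegrable_of_Icc`;
`fderiv_eq_zero_of_forall_notMem` (`…CutoffDivCurl`). `lean search 'integral_cutoff_sq|cutoff_energy_balance'`: no matches
(2026-08-17).

## References

* G. Seregin, J. Math. Fluid Mech. 24 (2022), Paper No. 27 = arXiv:2201.00153, §2 Step 3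
  (arXiv pp. 6–7). [`Seregin2022LocalAxisym`]
-/

noncomputable section

open MeasureTheory Set Filter Topology Function intervalIntegral
open scoped ENNReal ContDiff Laplacian
open Literature.Analysis.FluidPDE

-- `<Problem> = <Summit>` duplicates a namespace component by design (lakefile sets the same option).
set_option linter.dupNamespace false

namespace Summit.NavierStokesRegularity.NavierStokesRegularity.Theorems.AxisymmetricKatoGlobal.EulerScaling

/-! ### Time-dependent cut-offs: the weighted energy, its derivative, continuity in time -/

section Balance

variable {S : Set ℝ} {ζ G : ℝ → EuclideanSpace ℝ (Fin 3) → ℝ} {K : Set (EuclideanSpace ℝ (Fin 3))}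

/-- **Continuity in time of a cut-off integral**: if `Ψ` is jointly continuous on `S × ℝ³` and
each slice vanishes off the compact `K`, then `t ↦ ∫ Ψ t` is continuous on `S`
(`continuousOn_integral_of_support_subset`). [folklore] -/
theorem continuousOn_integral_cutoff {Ψ : ℝ → EuclideanSpace ℝ (Fin 3) → ℝ} (hK : IsCompact K)
    (hΨ : ContinuousOn (uncurry Ψ) (S ×ˢ univ)) (hsupp : ∀ t ∈ S, ∀ x ∉ K, Ψ t x = 0) :
    ContinuousOn (fun t => ∫ x, Ψ t x) S :=
  continuousOn_integral_of_support_subset (μ := volume) hK hΨ hsupp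

/-- **The derivative of the weighted energy `∫ (ζG)²` on an open time set.** For `ζ, G` jointly
smooth on the open set `S`, `ζ` vanishing off a fixed compact `K`, and `t ∈ S`:
`d/dt ∫ (ζ t · G t)² = 2∫ ζ ∂ₜζ G² + 2∫ ζ² G ∂ₜG` (`∂ₜ = timeDerivWithin S`; differentiation under
the integral sign, `hasDerivAt_integral_of_support_subset`). This is the passage
`∫ η⁶ G ∂ₜG = ½∂ₜ∫(η³G)² − ½∫G²∂ₜη⁶` of Seregin 2022, §2 Step 3. [cite: Seregin2022LocalAxisym, §2 Step 3 (arXiv:2201.00153 p. 6, the terms ½∂ₜ∫(Gη³)² and ½∫G²∂ₜη⁶)] -/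
theorem hasDerivAt_integral_cutoff_sq (hS : IsOpen S) (hζ : IsSmoothSpaceTimeOn S ζ)
    (hG : IsSmoothSpaceTimeOn S G) (hK : IsCompact K) (hsupp : ∀ t ∈ S, ∀ x ∉ K, ζ t x = 0)
    {t : ℝ} (ht : t ∈ S) :
    HasDerivAt (fun s => ∫ x, (ζ s x * G s x) ^ 2)
      (2 * (∫ x, ζ t x * timeDerivWithin S ζ t x * G t x ^ 2) +
        2 * ∫ x, ζ t x ^ 2 * G t x * timeDerivWithin S G t x) t := by
  have hU : UniqueDiffOn ℝ S := hS.uniqueDiffOn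
  -- the jointly smooth integrand `Φ = (ζG)·(ζG)`
  have hP : IsSmoothSpaceTimeOn S fun s x => ζ s x * G s x := hζ.mul hG
  have hΦ : IsSmoothSpaceTimeOn S fun s x => (ζ s x * G s x) * (ζ s x * G s x) := hP.mul hP
  have hΦsupp : ∀ s ∈ S, ∀ x ∉ K, (ζ s x * G s x) * (ζ s x * G s x) = 0 := fun s hs x hx => by
    simp [hsupp s hs x hx]
  have hD := hasDerivAt_integral_of_support_subset (μ := volume) hS hΦ hK hΦsupp ht
  have hfun : (fun s => ∫ x, (ζ s x * G s x) ^ 2) = fun s => ∫ x, (ζ s x * G s x) * (ζ s x * G s x) := by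
    funext s
    exact integral_congr_ae (Eventually.of_forall fun x => by simp only; ring)
  rw [hfun]
  refine hD.congr_deriv ?_
  -- identify the derivative of the integrand
  have hζ' : ∀ x, HasDerivAt (fun s => ζ s x) (timeDerivWithin S ζ t x) t := fun x => by
    rw [timeDerivWithin_eq_deriv hS ht ζ x]
    exact hζ.hasDerivAt_timeLine hS ht x
  have hG' : ∀ x, HasDerivAt (fun s => G s x) (timeDerivWithin S G t x) t := fun x => by
    rw [timeDerivWithin_eq_deriv hS ht G x]
    exact hG.hasDerivAt_timeLine hS ht x
  have hpt : ∀ x, deriv (fun s => (ζ s x * G s x) * (ζ s x * G s x)) t =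
      2 * (ζ t x * timeDerivWithin S ζ t x * G t x ^ 2) +
        2 * (ζ t x ^ 2 * G t x * timeDerivWithin S G t x) := by
    intro x
    have h : HasDerivAt (fun s => ζ s x * G s x * (ζ s x * G s x))
        ((timeDerivWithin S ζ t x * G t x + ζ t x * timeDerivWithin S G t x) * (ζ t x * G t x) +
          (ζ t x * G t x) * (timeDerivWithin S ζ t x * G t x + ζ t x * timeDerivWithin S G t x)) t :=
      ((hζ' x).mul (hG' x)).mul ((hζ' x).mul (hG' x))
    rw [h.deriv]
    ring
  -- integrability of the two pieces (continuous, supported in `K`)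
  have cζ : Continuous (ζ t) := (hζ.contDiff_slice ht).continuous
  have cG : Continuous (G t) := (hG.contDiff_slice ht).continuous
  have cζ' : Continuous (timeDerivWithin S ζ t) := ((hζ.timeDerivWithin hU).contDiff_slice ht).continuous
  have cG' : Continuous (timeDerivWithin S G t) := ((hG.timeDerivWithin hU).contDiff_slice ht).continuous
  have hζc : HasCompactSupport (ζ t) := HasCompactSupport.intro hK (hsupp t ht)
  have i1 : Integrable (fun x => ζ t x * timeDerivWithin S ζ t x * G t x ^ 2) :=
    (((cζ.mul cζ').mul (cG.pow 2))).integrable_of_hasCompactSupport (hζc.mul_right).mul_right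
  have i2 : Integrable (fun x => ζ t x ^ 2 * G t x * timeDerivWithin S G t x) :=
    integrable_sq_mul_mul cζ hζc cG cG'
  rw [integral_congr_ae (Eventually.of_forall hpt), integral_add (i1.const_mul 2) (i2.const_mul 2),
    MeasureTheory.integral_const_mul, MeasureTheory.integral_const_mul]

/-- **The weighted energy balance on a time interval**: under the hypotheses of
`hasDerivAt_integral_cutoff_sq`, for `t₁ ≤ t₂` with `[t₁, t₂] ⊆ S`,
`∫ (ζG)²(t₂) − ∫ (ζG)²(t₁) = ∫_{t₁}^{t₂} (2∫ ζ∂ₜζ G² + 2∫ ζ²G ∂ₜG) dt`, the density being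
continuous on `S`. [cite: Seregin2022LocalAxisym, §2 Step 3 (arXiv:2201.00153 p. 7, integration in time of the key differential inequality)] -/
theorem integral_cutoff_sq_sub_eq (hS : IsOpen S) (hζ : IsSmoothSpaceTimeOn S ζ)
    (hG : IsSmoothSpaceTimeOn S G) (hK : IsCompact K) (hsupp : ∀ t ∈ S, ∀ x ∉ K, ζ t x = 0)
    {t₁ t₂ : ℝ} (h12 : t₁ ≤ t₂) (hsub : Icc t₁ t₂ ⊆ S) :
    ContinuousOn (fun t => 2 * (∫ x, ζ t x * timeDerivWithin S ζ t x * G t x ^ 2) +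
        2 * ∫ x, ζ t x ^ 2 * G t x * timeDerivWithin S G t x) S ∧
    (∫ x, (ζ t₂ x * G t₂ x) ^ 2) - ∫ x, (ζ t₁ x * G t₁ x) ^ 2 =
      ∫ t in t₁..t₂, (2 * (∫ x, ζ t x * timeDerivWithin S ζ t x * G t x ^ 2) +
        2 * ∫ x, ζ t x ^ 2 * G t x * timeDerivWithin S G t x) := by
  have hU : UniqueDiffOn ℝ S := hS.uniqueDiffOn
  have hζ' : IsSmoothSpaceTimeOn S (timeDerivWithin S ζ) := hζ.timeDerivWithin hU
  have hG' : IsSmoothSpaceTimeOn S (timeDerivWithin S G) := hG.timeDerivWithin hU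
  have c1 : ContinuousOn (fun t => ∫ x, ζ t x * timeDerivWithin S ζ t x * G t x ^ 2) S := by
    have hsm : IsSmoothSpaceTimeOn S fun t x => ζ t x * timeDerivWithin S ζ t x * G t x ^ 2 := by
      have := (hζ.mul hζ').mul (hG.mul hG)
      exact this.congr (fun z _ => by simp only [uncurry]; ring)
    exact continuousOn_integral_cutoff hK hsm.continuousOn fun t ht x hx => by simp [hsupp t ht x hx]
  have c2 : ContinuousOn (fun t => ∫ x, ζ t x ^ 2 * G t x * timeDerivWithin S G t x) S := by
    have hsm : IsSmoothSpaceTimeOn S fun t x => ζ t x ^ 2 * G t x * timeDerivWithin S G t x := by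
      have := ((hζ.mul hζ).mul hG).mul hG'
      exact this.congr (fun z _ => by simp only [uncurry]; ring)
    exact continuousOn_integral_cutoff hK hsm.continuousOn fun t ht x hx => by simp [hsupp t ht x hx]
  have hcont : ContinuousOn (fun t => 2 * (∫ x, ζ t x * timeDerivWithin S ζ t x * G t x ^ 2) +
      2 * ∫ x, ζ t x ^ 2 * G t x * timeDerivWithin S G t x) S :=
    (continuousOn_const.mul c1).add (continuousOn_const.mul c2)
  refine ⟨hcont, ?_⟩
  rw [intervalIntegral.integral_eq_sub_of_hasDerivAt]
  · intro t ht
    rw [uIcc_of_le h12] at ht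
    exact hasDerivAt_integral_cutoff_sq hS hζ hG hK hsupp (hsub ht)
  · exact (hcont.mono hsub).intervalIntegrable_of_Icc h12

end Balance

/-! ### From the fixed-time inequality to the integrated one -/

section Integrated

variable {S : Set ℝ} {ν : ℝ} {ζ G R : ℝ → EuclideanSpace ℝ (Fin 3) → ℝ}
  {b : ℝ → EuclideanSpace ℝ (Fin 3) → EuclideanSpace ℝ (Fin 3)} {K : Set (EuclideanSpace ℝ (Fin 3))}

/-- **Integration in time of the localised energy inequality** ("the key estimate can be derived
by more or less standard arguments", Seregin 2022, §2 Step 3, arXiv p. 7 — its first half: from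
the differential to the integrated form). Let `S` be an open interval, `ζ, G, R` scalar and `b`
vector families jointly smooth on `S × ℝ³`, `ζ` vanishing off a fixed compact `K`, and suppose the
fixed-time inequality
`∫ ζ²G ∂ₜG + ν∫|∇(ζG)|² ≤ ∫ ζG² Dζ[b] + ν∫ G²|∇ζ|² − 2ν∫ ζG² q_ζ + ∫ ζ²G R` holds at every
`t ∈ S` (`∂ₜ = timeDerivWithin S`, `q_ζ = radDerivQuot ζ`; this is `integral_cutoff_energy_le`).
Then for `[t₁, t₂] ⊆ S`, with `E(t) = ∫(ζG)²(t)`: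
`E(t₂) + 2ν∫_{t₁}^{t₂}∫|∇(ζG)|² ≤ E(t₁) + ∫_{t₁}^{t₂}[2∫ζ∂ₜζG² + 2∫ζG²Dζ[b] + 2ν∫G²|∇ζ|² − 4ν∫ζG²q_ζ + 2∫ζ²GR]`,
all time integrands being continuous on `S`. [cite: Seregin2022LocalAxisym, §2 Step 3 (arXiv:2201.00153 p. 7, "the key estimate can be derived by more or less standard arguments")] -/
theorem integral_cutoff_sq_add_le_of_forall_le : ∀ (S : Set ℝ) (ν : ℝ) (ζ G R : ℝ → EuclideanSpace ℝ (Fin 3) → ℝ) (b : ℝ → EuclideanSpace ℝ (Fin 3) → EuclideanSpace ℝ (Fin 3)) (K : Set (EuclideanSpace ℝ (Fin 3))) (t₁ t₂ : ℝ), IsOpen S → Convex ℝ S → IsSmoothSpaceTimeOn S ζ → IsSmoothSpaceTimeOn S G → IsSmoothSpaceTimeOn S R → IsSmoothSpaceTimeOn S b → IsCompact K → (∀ t ∈ S, ∀ x ∉ K, ζ t x = 0) → (∀ t ∈ S, (∫ x, ζ t x ^ 2 * G t x * timeDerivWithin S G t x) + ν * ∫ x, (fderiv ℝ (fun y => ζ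 t y * G t y) x (EuclideanSpace.single 0 1) ^ 2 + fderiv ℝ (fun y => ζ t y * G t y) x (EuclideanSpace.single 1 1) ^ 2 + fderiv ℝ (fun y => ζ t y * G t y) x (EuclideanSpace.single 2 1) ^ 2) ≤ (∫ x, ζ t x * G t x ^ 2 * fderiv ℝ (ζ t) x (b t x)) + ν * (∫ x, G t x ^ 2 * (fderiv ℝ (ζ t) x (EuclideanSpace.single 0 1) ^ 2 + fderiv ℝ (ζ t) x (EuclideanSpace.single 1 1) ^ 2 + fderiv ℝ (ζ t) x (EuclideanSpace.single 2 1) ^ 2)) - 2 * ν * (∫ x, ζ t x * G t x ^ 2 * radDerivQuot (ζ t) x) + ∫ x, ζ t x ^ 2 * G t x * R t x) → t₁ ≤ t₂ → Icc t₁ t₂ ⊆ S → (∫ x, (ζ t₂ x * G t₂ x) ^ 2) + 2 * ν * ∫ t in t₁..t₂, ∫ x, (fderiv ℝ (fun y => ζ t y * G t y) x (EuclideanSpace.single 0 1) ^ 2 + fderiv ℝ (fun y => ζ t y * G t y) x (EuclideanSpace.single 1 1) ^ 2 + fderiv ℝ (fun y => ζ t y * G t y) x (EuclideanSpace.single 2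 1) ^ 2) ≤ (∫ x, (ζ t₁ x * G t₁ x) ^ 2) + ∫ t in t₁..t₂, (2 * (∫ x, ζ t x * timeDerivWithin S ζ t x * G t x ^ 2) + 2 * (∫ x, ζ t x * G t x ^ 2 * fderiv ℝ (ζ t) x (b t x)) + 2 * ν * (∫ x, G t x ^ 2 * (fderiv ℝ (ζ t) x (EuclideanSpace.single 0 1) ^ 2 + fderiv ℝ (ζ t) x (EuclideanSpace.single 1 1) ^ 2 + fderiv ℝ (ζ t) x (EuclideanSpace.single 2 1) ^ 2)) - 4 * ν * (∫ x, ζ t x * G t x ^ 2 * radDerivQuot (ζ t) x) + 2 * ∫ x, ζ t x ^ 2 * G t x * R t x) := by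
  intro S ν ζ G R b K t₁ t₂ hS hc hζ hG hR hb hK hsupp hfix h12 hsub
  have hU : UniqueDiffOn ℝ S := hS.uniqueDiffOn
  -- the generic balance
  obtain ⟨hdens, hbal⟩ := integral_cutoff_sq_sub_eq hS hζ hG hK hsupp h12 hsub
  -- the dissipation and the right-hand side are continuous in time
  have hP : IsSmoothSpaceTimeOn S fun s y => ζ s y * G s y := hζ.mul hG
  have hPsupp : ∀ s ∈ S, ∀ x ∉ K, ζ s x * G s x = 0 := fun s hs x hx => by
    simp [hsupp s hs x hx]
  have hDi : ∀ i : Fin 3, IsSmoothSpaceTimeOn S fun s x =>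
      fderiv ℝ (fun y => ζ s y * G s y) x (EuclideanSpace.single i 1) := fun i =>
    hP.fderiv_slice_apply hU _
  have cD : ContinuousOn (fun t => ∫ x,
      (fderiv ℝ (fun y => ζ t y * G t y) x (EuclideanSpace.single 0 1) ^ 2 +
        fderiv ℝ (fun y => ζ t y * G t y) x (EuclideanSpace.single 1 1) ^ 2 +
        fderiv ℝ (fun y => ζ t y * G t y) x (EuclideanSpace.single 2 1) ^ 2)) S := by
    have hsmD : IsSmoothSpaceTimeOn S fun t x =>
        fderiv ℝ (fun y => ζ t y * G t y) x (EuclideanSpace.single 0 1) ^ 2 +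
        fderiv ℝ (fun y => ζ t y * G t y) x (EuclideanSpace.single 1 1) ^ 2 +
        fderiv ℝ (fun y => ζ t y * G t y) x (EuclideanSpace.single 2 1) ^ 2 := by
      have := (((hDi 0).mul (hDi 0)).add ((hDi 1).mul (hDi 1))).add ((hDi 2).mul (hDi 2))
      exact this.congr (fun z _ => by simp only [uncurry]; ring)
    refine continuousOn_integral_cutoff hK hsmD.continuousOn fun t ht x hx => ?_
    have h0 : fderiv ℝ (fun y => ζ t y * G t y) x = 0 :=
      fderiv_eq_zero_of_forall_notMem hK.isClosed (hPsupp t ht) hx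
    simp [h0]
  have hDζb : IsSmoothSpaceTimeOn S fun s x => fderiv ℝ (ζ s) x (b s x) :=
    (hζ.fderiv_slice hU).clm_apply hb
  have hζi : ∀ i : Fin 3, IsSmoothSpaceTimeOn S fun s x => fderiv ℝ (ζ s) x (EuclideanSpace.single i 1) :=
    fun i => hζ.fderiv_slice_apply hU _
  have hqζ : IsSmoothSpaceTimeOn S fun s => radDerivQuot (ζ s) := hζ.radDerivQuot_family hc hU
  have hζ' : IsSmoothSpaceTimeOn S (timeDerivWithin S ζ) := hζ.timeDerivWithin hU
  have c0 : ContinuousOn (fun t => ∫ x, ζ t x * timeDerivWithin S ζ t x * G t x ^ 2) S := by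
    have hsm' : IsSmoothSpaceTimeOn S fun t x => ζ t x * timeDerivWithin S ζ t x * G t x ^ 2 := by
      have := (hζ.mul hζ').mul (hG.mul hG)
      exact this.congr (fun z _ => by simp only [uncurry]; ring)
    exact continuousOn_integral_cutoff hK hsm'.continuousOn fun t ht x hx => by simp [hsupp t ht x hx]
  have c1 : ContinuousOn (fun t => ∫ x, ζ t x * G t x ^ 2 * fderiv ℝ (ζ t) x (b t x)) S := by
    have hsm' : IsSmoothSpaceTimeOn S fun t x => ζ t x * G t x ^ 2 * fderiv ℝ (ζ t) x (b t x) := by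
      have := (hζ.mul (hG.mul hG)).mul hDζb
      exact this.congr (fun z _ => by simp only [uncurry]; ring)
    exact continuousOn_integral_cutoff hK hsm'.continuousOn fun t ht x hx => by simp [hsupp t ht x hx]
  have c2 : ContinuousOn (fun t => ∫ x, G t x ^ 2 *
      (fderiv ℝ (ζ t) x (EuclideanSpace.single 0 1) ^ 2 + fderiv ℝ (ζ t) x (EuclideanSpace.single 1 1) ^ 2 +
        fderiv ℝ (ζ t) x (EuclideanSpace.single 2 1) ^ 2)) S := by
    have hsm' : IsSmoothSpaceTimeOn S fun t x => G t x ^ 2 *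
        (fderiv ℝ (ζ t) x (EuclideanSpace.single 0 1) ^ 2 + fderiv ℝ (ζ t) x (EuclideanSpace.single 1 1) ^ 2 +
          fderiv ℝ (ζ t) x (EuclideanSpace.single 2 1) ^ 2) := by
      have := (hG.mul hG).mul ((((hζi 0).mul (hζi 0)).add ((hζi 1).mul (hζi 1))).add ((hζi 2).mul (hζi 2)))
      exact this.congr (fun z _ => by simp only [uncurry]; ring)
    refine continuousOn_integral_cutoff hK hsm'.continuousOn fun t ht x hx => ?_
    have h0 : fderiv ℝ (ζ t) x = 0 := fderiv_eq_zero_of_forall_notMem hK.isClosed (hsupp t ht) hx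
    simp [h0]
  have c3 : ContinuousOn (fun t => ∫ x, ζ t x * G t x ^ 2 * radDerivQuot (ζ t) x) S := by
    have hsm' : IsSmoothSpaceTimeOn S fun t x => ζ t x * G t x ^ 2 * radDerivQuot (ζ t) x := by
      have := (hζ.mul (hG.mul hG)).mul hqζ
      exact this.congr (fun z _ => by simp only [uncurry]; ring)
    exact continuousOn_integral_cutoff hK hsm'.continuousOn fun t ht x hx => by simp [hsupp t ht x hx]
  have c4 : ContinuousOn (fun t => ∫ x, ζ t x ^ 2 * G t x * R t x) S := by
    have hsm' : IsSmoothSpaceTimeOn S fun t x => ζ t x ^ 2 * G t x * R t x := by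
      have := ((hζ.mul hζ).mul hG).mul hR
      exact this.congr (fun z _ => by simp only [uncurry]; ring)
    exact continuousOn_integral_cutoff hK hsm'.continuousOn fun t ht x hx => by simp [hsupp t ht x hx]
  -- the pointwise-in-time inequality
  have hpt : ∀ t ∈ Icc t₁ t₂,
      (2 * (∫ x, ζ t x * timeDerivWithin S ζ t x * G t x ^ 2) +
        2 * ∫ x, ζ t x ^ 2 * G t x * timeDerivWithin S G t x) +
      2 * ν * (∫ x,
        (fderiv ℝ (fun y => ζ t y * G t y) x (EuclideanSpace.single 0 1) ^ 2 +
          fderiv ℝ (fun y => ζ t y * G t y) x (EuclideanSpace.single 1 1) ^ 2 +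
          fderiv ℝ (fun y => ζ t y * G t y) x (EuclideanSpace.single 2 1) ^ 2)) ≤
      2 * (∫ x, ζ t x * timeDerivWithin S ζ t x * G t x ^ 2) +
        2 * (∫ x, ζ t x * G t x ^ 2 * fderiv ℝ (ζ t) x (b t x)) +
        2 * ν * (∫ x, G t x ^ 2 * (fderiv ℝ (ζ t) x (EuclideanSpace.single 0 1) ^ 2 +
          fderiv ℝ (ζ t) x (EuclideanSpace.single 1 1) ^ 2 +
          fderiv ℝ (ζ t) x (EuclideanSpace.single 2 1) ^ 2)) -
        4 * ν * (∫ x, ζ t x * G t x ^ 2 * radDerivQuot (ζ t) x) +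
        2 * ∫ x, ζ t x ^ 2 * G t x * R t x := by
    intro t ht12
    nlinarith [hfix t (hsub ht12)]
  -- integrate in time
  have hIdens := (hdens.mono hsub).intervalIntegrable_of_Icc (μ := volume) h12
  have hID := (cD.mono hsub).intervalIntegrable_of_Icc (μ := volume) h12
  have hIF : IntervalIntegrable (fun t =>
      2 * (∫ x, ζ t x * timeDerivWithin S ζ t x * G t x ^ 2) +
        2 * (∫ x, ζ t x * G t x ^ 2 * fderiv ℝ (ζ t) x (b t x)) +
        2 * ν * (∫ x, G t x ^ 2 * (fderiv ℝ (ζ t) x (EuclideanSpace.single 0 1) ^ 2 +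
          fderiv ℝ (ζ t) x (EuclideanSpace.single 1 1) ^ 2 +
          fderiv ℝ (ζ t) x (EuclideanSpace.single 2 1) ^ 2)) -
        4 * ν * (∫ x, ζ t x * G t x ^ 2 * radDerivQuot (ζ t) x) +
        2 * ∫ x, ζ t x ^ 2 * G t x * R t x) volume t₁ t₂ := by
    refine (ContinuousOn.mono ?_ hsub).intervalIntegrable_of_Icc h12
    exact ((((continuousOn_const.mul c0).add (continuousOn_const.mul c1)).add
      (continuousOn_const.mul c2)).sub (continuousOn_const.mul c3)).add (continuousOn_const.mul c4)
  have hmono := intervalIntegral.integral_mono_on h12 (hIdens.add (hID.const_mul (2 * ν))) hIF hpt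
  rw [intervalIntegral.integral_add hIdens (hID.const_mul (2 * ν)),
    intervalIntegral.integral_const_mul] at hmono
  linarith [hbal, hmono]

end Integrated

end Summit.NavierStokesRegularity.NavierStokesRegularity.Theorems.AxisymmetricKatoGlobal.EulerScaling

end
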